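import Mathlib.Analysis.InnerProductSpace.Basic
import Mathlib.Analysis.InnerProductSpace.PiL2

/-!
# `MatrixDescartes` census — the TRIANGLE OBSTRUCTION in an arbitrary LORENTZIAN space (engine-4 g12, «LORENTZ-E4» memo §1(c))

HONEST FRAMING.  Object-search cell `pub-symmetroid`, crux `Theses.LacunarySymmetroid.MatrixDescartes`
(stmt-ValiantsHypothesis-18050).  The cell's layer-1 («sign class») support certificates rest on
`Census.polarDet_triangle_pos`: for three DEFINITE real symmetric `2 × 2` letters `S, T, U` the polar forms satisfy
`B(S,T) · B(T,U) · B(S,U) > 0`.  That statement is the two-nappe property of the timelike cone of the Lorentzian space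
`Sym₂(ℝ) ≅ ℝ^{1,2}` (with `det` as the quadratic form), and it holds verbatim in EVERY Lorentzian space `ℝ^{1,m}` — which is
what this file records, in coordinates `(s, x)` with `s : ℝ` the time coordinate, `x` a vector of a real inner product
space, and Lorentz pairing `L((s,x),(t,y)) = s t − ⟪x, y⟫`:

* `lorentzPair_mul_pos_of_timelike` — for timelike `(s,x)`, `(t,y)` (`‖x‖ < |s|`, `‖y‖ < |t|`) the pairing
  `s t − ⟪x,y⟫` has the sign of `s t` (Cauchy–Schwarz on the spatial parts);
* `lorentz_triangle_pos` — for three timelike vectors the product of the three pairings is positive;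
* `not_timelike_triangle_of_prod_neg` — contrapositive packaging: a «Gram triangle» with positive diagonal
  (`‖x_i‖ < |s_i|`) and NEGATIVE product of the three off-diagonal pairings cannot come from any Lorentzian space.

Consequence for the cell (bookkeeping, located in the memo HOME/pub-symmetroid-engine-4/lorentz/LORENTZ-E4.md): every
line «ζ(2,6;d) ≤ D(d) − 1» of the sign-class table is a statement about pencils over ANY Lorentzian quadratic space
(complex- or quaternion-Hermitian `2 × 2` letters, spin factors), with the same certificate.  Nothing here bears on
`ζ_sym(2,6)`, on `DoorA26 = PosRootLawAt 2 6 19` (OPEN), on the crux, or on `VP ≠ VNP`.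

[folklore] Elementary Lorentzian geometry (reverse triangle / time-orientation sign rule).
-/

-- `Summit.ValiantsHypothesis.ValiantsHypothesis.…` repeats a component by the D-0017 layout
-- (single-conjunct summit), which the `dupNamespace` linter flags; the name is mandated.
set_option linter.dupNamespace false

namespace Summit.ValiantsHypothesis.ValiantsHypothesis.Theorems.LacunarySymmetroidMatrixDescartes.Census

open RealInnerProductSpace

variable {E : Type*} [NormedAddCommGroup E] [InnerProductSpace ℝ E]

/-- **Time-orientation sign rule.**  In `ℝ ⊕ E` with the Lorentz pairing `s t − ⟪x, y⟫`: if `(s, x)` and `(t, y)` are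
timelike (`‖x‖ < |s|`, `‖y‖ < |t|`) then `(s t − ⟪x, y⟫) · (s t) > 0`, i.e. the pairing has the sign of `s t`
(Cauchy–Schwarz `|⟪x,y⟫| ≤ ‖x‖ ‖y‖ < |s| |t|`). [folklore] -/
theorem lorentzPair_mul_pos_of_timelike (s t : ℝ) (x y : E) (hs : ‖x‖ < |s|) (ht : ‖y‖ < |t|) :
    0 < (s * t - ⟪x, y⟫) * (s * t) := by
  have hcs : |⟪x, y⟫| ≤ ‖x‖ * ‖y‖ := abs_real_inner_le_norm x y
  have hst : ‖x‖ * ‖y‖ < |s| * |t| := mul_lt_mul'' hs ht (norm_nonneg x) (norm_nonneg y)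
  have key : |⟪x, y⟫| < |s * t| := by
    rw [abs_mul]; exact lt_of_le_of_lt hcs hst
  have hQ : 0 < |s * t| := lt_of_le_of_lt (abs_nonneg _) key
  have h1 : ⟪x, y⟫ * (s * t) ≤ |⟪x, y⟫| * |s * t| := by
    rw [← abs_mul]; exact le_abs_self _
  have h2 : |s * t| * |s * t| = (s * t) * (s * t) := abs_mul_abs_self _
  nlinarith [mul_pos hQ (sub_pos.mpr key), h1, h2]

/-- **The Lorentzian triangle obstruction.**  For three timelike vectors `(sᵢ, xᵢ)` of `ℝ ⊕ E` the product of the three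
Lorentz pairings `(s₁s₂ − ⟪x₁,x₂⟫)(s₂s₃ − ⟪x₂,x₃⟫)(s₁s₃ − ⟪x₁,x₃⟫)` is POSITIVE — the signature-general form of the cell's
`polarDet_triangle_pos` (which is the case `E = ℝ²`, `Sym₂(ℝ) ≅ ℝ^{1,2}`). [folklore] -/
theorem lorentz_triangle_pos (s₁ s₂ s₃ : ℝ) (x₁ x₂ x₃ : E)
    (h₁ : ‖x₁‖ < |s₁|) (h₂ : ‖x₂‖ < |s₂|) (h₃ : ‖x₃‖ < |s₃|) :
    0 < (s₁ * s₂ - ⟪x₁, x₂⟫) * (s₂ * s₃ - ⟪x₂, x₃⟫) * (s₁ * s₃ - ⟪x₁, x₃⟫) := by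
  have a := lorentzPair_mul_pos_of_timelike s₁ s₂ x₁ x₂ h₁ h₂
  have b := lorentzPair_mul_pos_of_timelike s₂ s₃ x₂ x₃ h₂ h₃
  have c := lorentzPair_mul_pos_of_timelike s₁ s₃ x₁ x₃ h₁ h₃
  have hs₁ : s₁ ≠ 0 := by
    intro h; rw [h, abs_zero] at h₁; exact (not_lt.mpr (norm_nonneg x₁)) h₁
  have hs₂ : s₂ ≠ 0 := by
    intro h; rw [h, abs_zero] at h₂; exact (not_lt.mpr (norm_nonneg x₂)) h₂
  have hs₃ : s₃ ≠ 0 := by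
    intro h; rw [h, abs_zero] at h₃; exact (not_lt.mpr (norm_nonneg x₃)) h₃
  have hsq : 0 < (s₁ * s₂ * s₃) ^ 2 := by positivity
  -- the product of the three positive quantities equals (the claimed product) × (s₁s₂s₃)²
  have habc := mul_pos (mul_pos a b) c
  have hrw : (s₁ * s₂ - ⟪x₁, x₂⟫) * (s₁ * s₂) * ((s₂ * s₃ - ⟪x₂, x₃⟫) * (s₂ * s₃)) *
      ((s₁ * s₃ - ⟪x₁, x₃⟫) * (s₁ * s₃)) =
      ((s₁ * s₂ - ⟪x₁, x₂⟫) * (s₂ * s₃ - ⟪x₂, x₃⟫) * (s₁ * s₃ - ⟪x₁, x₃⟫)) * (s₁ * s₂ * s₃) ^ 2 := by ring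
  rw [hrw] at habc
  rcases lt_trichotomy 0 ((s₁ * s₂ - ⟪x₁, x₂⟫) * (s₂ * s₃ - ⟪x₂, x₃⟫) * (s₁ * s₃ - ⟪x₁, x₃⟫)) with hX | hX | hX
  · exact hX
  · rw [← hX, zero_mul] at habc; exact (lt_irrefl _ habc).elim
  · exact (not_lt.mpr (mul_nonpos_of_nonpos_of_nonneg hX.le hsq.le) habc).elim

/-- **Packaging for the census dictionary.**  A «would-be-Gram triangle» — three indices with POSITIVE diagonal
pairings (timelike letters, `‖xᵢ‖ < |sᵢ|`) and NEGATIVE product of the three off-diagonal pairings — is not realised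
by letters of ANY Lorentzian space `ℝ ⊕ E`: this is LEMMA LZ-SIGN of the memo in its Gram form (the odd-triangle
hypothesis of `Census.card_posRoots_add_two_le_of_signClass` therefore excludes quaternion-Hermitian and spin-factor
realisations exactly as it excludes symmetric ones). [folklore] -/
theorem not_timelike_triangle_of_prod_neg (s₁ s₂ s₃ : ℝ) (x₁ x₂ x₃ : E)
    (h₁ : ‖x₁‖ < |s₁|) (h₂ : ‖x₂‖ < |s₂|) (h₃ : ‖x₃‖ < |s₃|)
    (hneg : (s₁ * s₂ - ⟪x₁, x₂⟫) * (s₂ * s₃ - ⟪x₂, x₃⟫) * (s₁ * s₃ - ⟪x₁, x₃⟫) < 0) : False :=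
  (lt_irrefl (0 : ℝ)) ((lorentz_triangle_pos s₁ s₂ s₃ x₁ x₂ x₃ h₁ h₂ h₃).trans hneg)


/-! ## Appended 2026-08-25 (engine-4 g12): the reverse Cauchy–Schwarz (Aczél) inequality — the signature-general form of the
T-NC «P rows» `Census.four_det_mul_det_le_polarDet_sq` (`4 det S det T ≤ B(S,T)²` for definite `S`). -/

/-- **Reverse Cauchy–Schwarz (Aczél) in a Lorentzian space.**  In `ℝ ⊕ E` with pairing `L((s,x),(t,y)) = s t − ⟪x,y⟫`:
if `(s, x)` is timelike (`‖x‖ < |s|`) then for every `(t, y)`,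
`(s² − ‖x‖²)(t² − ‖y‖²) ≤ (s t − ⟪x, y⟫)²` — the `2 × 2` Gram minor of a timelike vector and any vector is `≤ 0`.
(For `E = ℝ²`, `Sym₂(ℝ) ≅ ℝ^{1,2}`, this is the cell's `four_det_mul_det_le_polarDet_sq`.)  Proof: the quadratic
`λ ↦ L(u − λv, u − λv)` is positive at `λ = 0` and `≤ 0` at `λ = s/t` (where the time coordinate vanishes), so its
discriminant is non-negative; `t = 0` is immediate. [folklore] -/
theorem lorentz_reverse_cauchy_schwarz (s t : ℝ) (x y : E) (hs : ‖x‖ < |s|) :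
    (s ^ 2 - ‖x‖ ^ 2) * (t ^ 2 - ‖y‖ ^ 2) ≤ (s * t - ⟪x, y⟫) ^ 2 := by
  have hx0 : 0 ≤ ‖x‖ := norm_nonneg x
  have hss : ‖x‖ ^ 2 < s ^ 2 := by
    have := abs_nonneg s
    calc ‖x‖ ^ 2 < |s| ^ 2 := by nlinarith
      _ = s ^ 2 := sq_abs s
  by_cases ht : t = 0
  · subst ht
    have : 0 ≤ (s * 0 - ⟪x, y⟫) ^ 2 := sq_nonneg _
    nlinarith [sq_nonneg ‖y‖]
  · -- evaluate the Lorentz quadratic form at u - (s/t) v: time coordinate s - (s/t) t = 0, so the value is -‖x - (s/t) • y‖² ≤ 0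
    set μ : ℝ := s / t with hμ
    have hst : s - μ * t = 0 := by rw [hμ]; field_simp; ring
    have hnn : 0 ≤ ‖x - μ • y‖ ^ 2 := sq_nonneg _
    have hexp : ‖x - μ • y‖ ^ 2 = ‖x‖ ^ 2 - 2 * μ * ⟪x, y⟫ + μ ^ 2 * ‖y‖ ^ 2 := by
      rw [norm_sub_sq_real, inner_smul_right, norm_smul, mul_pow, Real.norm_eq_abs, sq_abs]; ring
    -- f(μ) = (s - μ t)² - ‖x - μ y‖² = -‖x - μ y‖² ≤ 0, and f(μ) = (s²-‖x‖²) - 2μ(st - ⟪x,y⟫) + μ²(t² - ‖y‖²)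
    have hf : (s ^ 2 - ‖x‖ ^ 2) - 2 * μ * (s * t - ⟪x, y⟫) + μ ^ 2 * (t ^ 2 - ‖y‖ ^ 2) ≤ 0 := by
      have : (s ^ 2 - ‖x‖ ^ 2) - 2 * μ * (s * t - ⟪x, y⟫) + μ ^ 2 * (t ^ 2 - ‖y‖ ^ 2)
          = (s - μ * t) ^ 2 - ‖x - μ • y‖ ^ 2 := by rw [hexp]; ring
      rw [this, hst]; nlinarith
    -- a quadratic a μ² - 2 b μ + c with c > 0 and a non-positive value has b² ≥ a c
    nlinarith [hf, hss, sq_nonneg (μ * (t ^ 2 - ‖y‖ ^ 2) - (s * t - ⟪x, y⟫)),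
      sq_nonneg μ, mul_pos (sub_pos.mpr hss) (sub_pos.mpr hss)]


/-! ## Appended 2026-08-25 (engine-4 g12): the BRIDGE `Sym₂(ℝ) ≅ ℝ^{1,2}` — the identities under which the cell's `2 × 2`
statements are the case `E = ℝ²` of the Lorentzian lemmas above (dictionary line (1a) of LORENTZ-E4.md in the kernel). -/

/-- The isometry `Sym₂(ℝ) → ℝ ⊕ ℝ²`, `[[a,b],[b,c]] ↦ ((a+c)/2, ((a−c)/2, b))`, carries `det` to the Lorentz form:
`ac − b² = ((a+c)/2)² − ‖((a−c)/2, b)‖²`. [folklore] -/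
theorem det_two_eq_lorentzForm (a b c : ℝ) :
    a * c - b ^ 2 = ((a + c) / 2) ^ 2 - ‖!₂[(a - c) / 2, b]‖ ^ 2 := by
  rw [EuclideanSpace.real_norm_sq_eq]; simp [Fin.sum_univ_two]; ring

/-- … and the polar form `B(S,T) = a c' + c a' − 2 b b'` to twice the Lorentz pairing. [folklore] -/
theorem polarDet_eq_two_mul_lorentzPair (a b c a' b' c' : ℝ) :
    a * c' + c * a' - 2 * (b * b') =
      2 * ((a + c) / 2 * ((a' + c') / 2) - ⟪!₂[(a - c) / 2, b], !₂[(a' - c') / 2, b']⟫) := by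
  have h : ⟪!₂[(a - c) / 2, b], !₂[(a' - c') / 2, b']⟫ = (a - c) / 2 * ((a' - c') / 2) + b * b' := by
    simp [PiLp.inner_apply, Fin.sum_univ_two, mul_comm]
  rw [h]; ring

/-- A definite `2 × 2` letter is a TIMELIKE vector: `ac − b² > 0 ⇒ ‖((a−c)/2, b)‖ < |(a+c)/2|`. [folklore] -/
theorem timelike_of_det_two_pos (a b c : ℝ) (h : 0 < a * c - b ^ 2) :
    ‖!₂[(a - c) / 2, b]‖ < |(a + c) / 2| := by
  have h' : ‖!₂[(a - c) / 2, b]‖ ^ 2 < ((a + c) / 2) ^ 2 := by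
    have := det_two_eq_lorentzForm a b c; linarith
  rw [← sq_abs ((a + c) / 2)] at h'
  exact lt_of_pow_lt_pow_left₀ 2 (abs_nonneg _) h'

/-! With these three identities the cell's `Census.polarDet_triangle_pos` (three definite letters) is literally
`lorentz_triangle_pos` at `E = ℝ²` and the P row `Census.four_det_mul_det_le_polarDet_sq` is `lorentz_reverse_cauchy_schwarz`
at `E = ℝ²` (after `rw [polarDet_eq_two_mul_lorentzPair, det_two_eq_lorentzForm]`, `timelike_of_det_two_pos` supplies the
hypothesis and `nlinarith` the factor `2²`); the re-derived statements are not restated here (they are the landed theorems). -/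

end Summit.ValiantsHypothesis.ValiantsHypothesis.Theorems.LacunarySymmetroidMatrixDescartes.Census
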